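import Mathlib
import Literature.Computability.AlgebraicComplexity.RealTauKnownCases
import Summits.ValiantsHypothesis.ValiantsHypothesis.Theses.FeketeSOS

/-!
# `FeketeBoundedFanin` — negative lemma: the "unipotent fewnomial abc" is false (crux triage r1-2)

Crux `stmt-ValiantsHypothesis-3998` (`FeketeSOS.FeketeBoundedFanin`), idea card `witt-pascal-ufa`
(`Cruxes/FeketeBoundedFanin/Ideas/witt-pascal-ufa.md`, Sketch `SketchIdeator2.lean`, decl
`WittPascal.UnipotentFewnomialABC`).  The card's load-bearing conjecture says: in characteristic `p`, for fewnomials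
`P_j, Q_j` (`j < k`) of degree `< p`, either `(X-1)^p ∣ ∏P − c∏Q` or `ord_{X=1}(∏P − c∏Q) ≤ C₀(k)·Σ_j(|P_j|+|Q_j|)`.
It is FALSE for every `C₀`, by the socle tiling (card `witt-jordan-staircase`'s `SocleTiling`; the digit identity of
`Negative.LoadBearing` read modulo `p`):  `X·(∑_{i<a}X^i)·(∑_{j<b}X^{aj}) + 1 = ∑_{m<p}X^m = (X−1)^{p−1}` when `ab = p−1`,
a `k = 2` instance (`P = (X·A, B)`, `Q = (1,1)`, `c = −1`) of exact order `p − 1 < p` with `a + b + 2` monomials; primes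
`p ≡ 1 (mod a)` with `(p−1)/a ≥ a = 3C₀(2)+3` exist (`Nat.exists_prime_gt_modEq_one`).  So every statement of this shape
must exclude the socle zone (orders `≥ p − 1 − B(k)`; order `p − 2` is also cheap: `(θA)B + A(θ+1)B = −(X−1)^{p−2}`).
The statement refuted below is `WittPascal.UnipotentFewnomialABC C₀` with its definition inlined verbatim.
-/

set_option linter.dupNamespace false

open Polynomial Finset
open scoped BigOperators

namespace Summit.ValiantsHypothesis.ValiantsHypothesis.Theorems.FeketeBoundedFanin.Negative

section helpers
variable {R : Type*} [CommRing R]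

/-- Block geometric series over any commutative ring: `(∑_{i<m} x^i)(∑_{j<n} x^{mj}) = ∑_{l<mn} x^l`. [folklore] -/
theorem geom_block_comm (x : R[X]) (m n : ℕ) :
    (∑ i ∈ range m, x ^ i) * (∑ j ∈ range n, x ^ (m * j)) = ∑ l ∈ range (m * n), x ^ l := by
  induction n with
  | zero => simp
  | succ n ih =>
    rw [Finset.sum_range_succ, mul_add, ih, Nat.mul_succ, Finset.sum_range_add, Finset.sum_mul]
    congr 1
    refine Finset.sum_congr rfl fun i _ => ?_
    rw [← pow_add, add_comm]

/-- A sum of `#s` monomials has at most `#s` monomials (any commutative ring). [folklore] -/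
theorem card_support_sum_X_pow_le_card (s : Finset ℕ) (f : ℕ → ℕ) :
    (∑ a ∈ s, (X : R[X]) ^ f a).support.card ≤ s.card := by
  refine (Literature.Computability.AlgebraicComplexity.card_support_sum_le s _).trans ?_
  calc ∑ a ∈ s, ((X : R[X]) ^ f a).support.card ≤ ∑ a ∈ s, 1 :=
        Finset.sum_le_sum fun a _ => by
          simpa using (card_support_C_mul_X_pow_le_one (R := R) (c := 1) (n := f a))
    _ = s.card := by simp

end helpers

/-- **The unipotent fewnomial abc (`WittPascal.UnipotentFewnomialABC C₀`, inlined verbatim) is false for every `C₀`.**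
Witness at `k = 2`: `P = (X·∑_{i<a}X^i, ∑_{j<b}X^{aj})`, `Q = (1, 1)`, `c = −1` over `ZMod p` with `ab = p − 1`,
`a = 3C₀(2)+3 ≤ b`: `∏P − C c·∏Q = ∑_{m<p} X^m = (X − 1)^{p−1}` has root multiplicity exactly `p − 1` at `1`
(not divisible by `(X−1)^p`), while `C₀(2)·(a + b + 2) < ab = p − 1`. [folklore] -/
theorem unipotentFewnomialABC_false (C₀ : ℕ → ℕ) :
    ¬ (∀ (K : Type) [Field K] (p : ℕ) [Fact p.Prime] [CharP K p] (k : ℕ) (P Q : Fin k → K[X]) (c : K),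
        (∀ j, P j ≠ 0 ∧ (P j).natDegree < p) → (∀ j, Q j ≠ 0 ∧ (Q j).natDegree < p) →
        (X - C 1) ^ p ∣ ((∏ j, P j) - C c * ∏ j, Q j) ∨
        ((∏ j, P j) - C c * ∏ j, Q j).rootMultiplicity 1
          ≤ C₀ k * ∑ j, ((P j).support.card + (Q j).support.card)) := by
  intro H
  set c := C₀ 2 with hc
  set a := 3 * c + 3 with ha
  have ha0 : a ≠ 0 := by omega
  have ha3 : 3 ≤ a := by omega
  obtain ⟨p, hp, hpa, hmod⟩ := Nat.exists_prime_gt_modEq_one (a * a) ha0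
  haveI : Fact p.Prime := ⟨hp⟩
  have hp1 : 1 ≤ p := hp.one_lt.le
  have hdvd : a ∣ p - 1 := (Nat.modEq_iff_dvd' hp1).mp hmod.symm
  obtain ⟨b, hb⟩ := hdvd
  have hab : a ≤ b := by
    have h1 : a * a ≤ a * b := by
      have : a * a < a * b + 1 := by omega
      omega
    exact Nat.le_of_mul_le_mul_left h1 (by omega)
  have hb0 : 0 < b := by omega
  have hbp : b < p := by
    have : b ≤ a * b := Nat.le_mul_of_pos_left b (by omega)
    omega
  have hap : a < p := by
    have : a ≤ a * a := Nat.le_mul_of_pos_left a (by omega)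
    omega
  -- the witness polynomials over K = ZMod p
  set XA : (ZMod p)[X] := ∑ i ∈ range a, X ^ (i + 1) with hXA
  set B : (ZMod p)[X] := ∑ j ∈ range b, X ^ (a * j) with hB
  have hXAB : XA * B = ∑ l ∈ range (a * b), (X : (ZMod p)[X]) ^ (l + 1) := by
    have h1 : XA = X * ∑ i ∈ range a, (X : (ZMod p)[X]) ^ i := by
      rw [hXA, Finset.mul_sum]
      exact Finset.sum_congr rfl fun i _ => by rw [pow_succ, mul_comm]
    rw [h1, hB, mul_assoc, geom_block_comm, Finset.mul_sum]
    exact Finset.sum_congr rfl fun l _ => by rw [pow_succ, mul_comm]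
  have hgeom : XA * B + 1 = ∑ m ∈ range p, (X : (ZMod p)[X]) ^ m := by
    rw [hXAB, ← hb, show range p = range (p - 1 + 1) from by rw [Nat.sub_add_cancel hp1],
      Finset.sum_range_succ']
    simp
  have hsocle : ∑ m ∈ range p, (X : (ZMod p)[X]) ^ m = (X - C 1) ^ (p - 1) := by
    have hne : (X - C (1 : ZMod p)) ≠ 0 := X_sub_C_ne_zero 1
    apply mul_right_cancel₀ hne
    rw [← pow_succ, Nat.sub_add_cancel hp1, map_one, geom_sum_mul, sub_pow_char, one_pow]
  set P : Fin 2 → (ZMod p)[X] := ![XA, B] with hPdef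
  set Q : Fin 2 → (ZMod p)[X] := ![1, 1] with hQdef
  have hXA_ne : XA ≠ 0 := by
    intro h0
    have h1 : XA.eval 1 = (a : ZMod p) := by
      rw [hXA, eval_finsetSum]; simp
    rw [h0, eval_zero] at h1
    have : (a : ZMod p) = 0 := h1.symm
    rw [ZMod.natCast_eq_zero_iff] at this
    exact absurd (Nat.le_of_dvd (by omega) this) (by omega)
  have hB_ne : B ≠ 0 := by
    intro h0
    have h1 : B.eval 1 = (b : ZMod p) := by
      rw [hB, eval_finsetSum]; simp
    rw [h0, eval_zero] at h1
    have : (b : ZMod p) = 0 := h1.symm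
    rw [ZMod.natCast_eq_zero_iff] at this
    exact absurd (Nat.le_of_dvd hb0 this) (by omega)
  have hXA_deg : XA.natDegree < p := by
    have : XA.natDegree ≤ a := by
      rw [hXA]
      exact natDegree_sum_le_of_forall_le _ _ fun i hi =>
        (natDegree_X_pow_le _).trans (by simp at hi; omega)
    omega
  have hB_deg : B.natDegree < p := by
    have : B.natDegree ≤ a * b := by
      rw [hB]
      exact natDegree_sum_le_of_forall_le _ _ fun j hj =>
        (natDegree_X_pow_le _).trans (by simp at hj; exact Nat.mul_le_mul_left a (by omega))
    omega
  have hP : ∀ j, P j ≠ 0 ∧ (P j).natDegree < p := by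
    intro j; fin_cases j
    · exact ⟨hXA_ne, hXA_deg⟩
    · exact ⟨hB_ne, hB_deg⟩
  have hQ : ∀ j, Q j ≠ 0 ∧ (Q j).natDegree < p := by
    intro j
    have h1 : Q j = 1 := by fin_cases j <;> rfl
    rw [h1, natDegree_one]
    exact ⟨one_ne_zero, hp.pos⟩
  have hprodP : (∏ j, P j) = XA * B := by rw [Fin.prod_univ_two]; rfl
  have hprodQ : (∏ j, Q j) = 1 := by
    rw [Fin.prod_univ_two]
    change (1 : (ZMod p)[X]) * 1 = 1
    rw [mul_one]
  have hval : (∏ j, P j) - C (-1 : ZMod p) * ∏ j, Q j = (X - C 1) ^ (p - 1) := by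
    rw [hprodP, hprodQ, map_neg, map_one, mul_one, sub_neg_eq_add, hgeom, hsocle, map_one]
  have hsum : (∑ j, ((P j).support.card + (Q j).support.card)) ≤ a + b + 2 := by
    have hsXA : XA.support.card ≤ a := by
      have h := card_support_sum_X_pow_le_card (R := ZMod p) (range a) (fun i => i + 1)
      rwa [Finset.card_range, ← hXA] at h
    have hsB : B.support.card ≤ b := by
      have h := card_support_sum_X_pow_le_card (R := ZMod p) (range b) (fun j => a * j)
      rwa [Finset.card_range, ← hB] at h
    have hs1 : (1 : (ZMod p)[X]).support.card ≤ 1 := by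
      have h := card_support_C_mul_X_pow_le_one (R := ZMod p) (c := 1) (n := 0)
      rwa [map_one, pow_zero, mul_one] at h
    rw [Fin.sum_univ_two]
    change (XA.support.card + (1 : (ZMod p)[X]).support.card) +
      (B.support.card + (1 : (ZMod p)[X]).support.card) ≤ a + b + 2
    omega
  rcases H (ZMod p) p 2 P Q (-1) hP hQ with hdiv | hle
  · rw [hval] at hdiv
    have hne : ((X - C (1 : ZMod p)) ^ (p - 1)) ≠ 0 := pow_ne_zero _ (X_sub_C_ne_zero 1)
    have := (le_rootMultiplicity_iff hne).mpr hdiv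
    rw [rootMultiplicity_X_sub_C_pow] at this
    omega
  · rw [hval, rootMultiplicity_X_sub_C_pow] at hle
    have h2 : p - 1 ≤ c * (a + b + 2) := hle.trans (Nat.mul_le_mul_left _ hsum)
    have h3 : c * (a + b + 2) < a * b := by nlinarith
    omega

end Summit.ValiantsHypothesis.ValiantsHypothesis.Theorems.FeketeBoundedFanin.Negative
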